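import Summits.CriticalPhenomena.PercolationContinuityZ3.Theorems.PercNearOneGluingNoHeavyQuantResplitScaleDefectSubcritical
import Summits.CriticalPhenomena.PercolationContinuityZ3.Theorems.PercNearOneGluingNoHeavyQuantResplitDisplaysMidD
import HarnessLib

/-!
# QUANT lane / PAPER-2 rate track (ARM-2, gen 12): the `d = 4, 5, 6`, `3 ≤ d ≤ 32` and `d = 7..10` companions of the display of record
# for EVERY `p ≤ p_c(ℤ^d)`, WITHOUT Barsky–Grimmett–Newman (re-balanced cascade, Peierls constant `2⁻³`)

builds on p205010 (kernel theorem, internal audit signed; external expert review pending)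

Cell `prim-quant`, seat `prim-quant-arm-2` (constants bookkeeper; `RATE-CONSTANTS.md` §2k).  Companion of `…QuantResplitScaleDefectSubcritical`
(ARM-2 g12), which proves the re-balanced scale defect on the closed window `[critDelta d, p_c]` against the DEFINITION of `p_c` + continuity in `p`
(`rsThreeScaleDefect_of_le_criticalProbI_orbit`) and the `d = 3` display for every `p ≤ p_c(ℤ³)`.  Here the same one-line assembly
(`PkSharp.oneArm_le_base_pow_of_scaleDefect` + bridge `rsLHi_le_knLHi` + the kernel sandwiches of `…QuantResplitNumerals` / `…QuantResplitDisplaysMidD`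
+ monotone coupling below `critDelta d`, `Resplit.oneArm_le_of_window`) gives, for every `p ≤ p_c(ℤ^d)` and every `N`:
`π_p(N) ≤ (1 − 2^{−k_d})^⌊(log*₂ N − 6)/2⌋` with `k_4 = 4817`, `k_5 = 12211`, `k_6 = 29647`, `k_7 = 69866`, `k_8 = 161085`, `k_9 = 365242`,
`k_10 = 817280`, and `π_p(N) ≤ (1 − ((1/2)^66/(d+1)^4)^(d·2^d))^⌊(log*₂ N − 6)/2⌋` for every `3 ≤ d ≤ 32`.  The `p = p_c` instances — literally the
types of `Resplit.oneArm_rate_Z4/Z5/Z6/Z7/Z8/Z9/Z10_three_resplit` and `Resplit.oneArm_rate_three_resplit_uniform` — are `example`s (the gate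
de-duplicates theorems by type), so those landed displays too acquire a declaration cone free of the half-space theorem, of the ergodic 0-1 law and
of the `d = 2` theorems (cone probe in the companion's module docstring).
HONEST SIZE / SENTENCE (unchanged): explicit functions tending to `0` of iterated-logarithm type and nothing more; class log*, every constant and
the instance of record UNCHANGED; polylog / power law OPEN.  No definitions, no sorries.
[cite: KozmaNitzan2024, §4 Theorem 6 and Lemmas 10–12 (pp. 15–31)] [cite: DuminilcopinKozmaTassion2020, Proposition 1]
[cite: GrimmettPercolation1999, §7.3 p. 162; proof of Thm (7.35) p. 169; Thm (2.1)]
-/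

noncomputable section

namespace Summit.CriticalPhenomena.PercolationContinuityZ3.Theorems.Quant

open MeasureTheory Literature.Probability.Percolation Literature.Probability.LatticeModels
open Literature.Probability.Percolation.KozmaNitzan Literature.Probability.Percolation.AKN
open scoped Classical

namespace Resplit

variable {d : ℕ}

/-! ## `d = 4, 5, 6` -/

/-- **`ℤ⁴`, every `p ≤ p_c(ℤ⁴)`, without Barsky–Grimmett–Newman**: `π_p(N) ≤ (1 − 2⁻⁴⁸¹⁷)^⌊(log*₂ N − 6)/2⌋`; at `p = p_c` the type of
`Resplit.oneArm_rate_Z4_three_resplit`.  An explicit function tending to `0` and nothing more.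
builds on p205010 (kernel theorem, internal audit signed; external expert review pending). [cite: KozmaNitzan2024, §4 Theorem 6] -/
theorem oneArm_rate_Z4_three_resplit_of_le_criticalProbI (p : unitInterval) (hpc : p ≤ criticalProbI 4) (N : ℕ) :
    oneArmProb 4 p N ≤ (1 - (1 / 2 : ℝ) ^ 4817) ^ ((logStar 2 N - 6) / 2) :=
  oneArm_le_of_window (d := 4) (by norm_num) (B := fun N => (1 - (1 / 2 : ℝ) ^ 4817) ^ ((logStar 2 N - 6) / 2))
    (fun q hq hqc N => PkSharp.oneArm_le_base_pow_of_scaleDefect (by norm_num)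
      (rsThreeScaleDefect_of_le_criticalProbI_orbit (d := 4) (by norm_num) q hq hqc) (fun m => le_rsLHi _ 4 m)
      (fun m => rsLHi_le_knLHi (d := 4) (by norm_num) knEps_le_half_pow_three_div_two (by positivity) (by norm_num) m) (by positivity)
      rsOrbit_three_four_sharp.1.le (rsTauU_pow_orbit_le_one 4 (by positivity) (by norm_num)) knShiftC_four_eq.le N)
    p hpc N

-- the `p = p_c` instance: the TYPE of `Resplit.oneArm_rate_Z4_three_resplit`, BGN-free
example (N : ℕ) : oneArmProb 4 (criticalProbI 4) N ≤ (1 - (1 / 2 : ℝ) ^ 4817) ^ ((logStar 2 N - 6) / 2) :=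
  oneArm_rate_Z4_three_resplit_of_le_criticalProbI (criticalProbI 4) le_rfl N

/-- **`ℤ⁵`, every `p ≤ p_c(ℤ⁵)`, without Barsky–Grimmett–Newman**: `π_p(N) ≤ (1 − 2⁻¹²²¹¹)^⌊(log*₂ N − 6)/2⌋`; at `p = p_c` the type of
`Resplit.oneArm_rate_Z5_three_resplit`.  An explicit function tending to `0` and nothing more.
builds on p205010 (kernel theorem, internal audit signed; external expert review pending). [cite: KozmaNitzan2024, §4 Theorem 6] -/
theorem oneArm_rate_Z5_three_resplit_of_le_criticalProbI (p : unitInterval) (hpc : p ≤ criticalProbI 5) (N : ℕ) :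
    oneArmProb 5 p N ≤ (1 - (1 / 2 : ℝ) ^ 12211) ^ ((logStar 2 N - 6) / 2) :=
  oneArm_le_of_window (d := 5) (by norm_num) (B := fun N => (1 - (1 / 2 : ℝ) ^ 12211) ^ ((logStar 2 N - 6) / 2))
    (fun q hq hqc N => PkSharp.oneArm_le_base_pow_of_scaleDefect (by norm_num)
      (rsThreeScaleDefect_of_le_criticalProbI_orbit (d := 5) (by norm_num) q hq hqc) (fun m => le_rsLHi _ 5 m)
      (fun m => rsLHi_le_knLHi (d := 5) (by norm_num) knEps_le_half_pow_three_div_two (by positivity) (by norm_num) m) (by positivity)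
      rsOrbit_three_five_sharp.1.le (rsTauU_pow_orbit_le_one 5 (by positivity) (by norm_num)) knShiftC_five_eq.le N)
    p hpc N

-- the `p = p_c` instance: the TYPE of `Resplit.oneArm_rate_Z5_three_resplit`, BGN-free
example (N : ℕ) : oneArmProb 5 (criticalProbI 5) N ≤ (1 - (1 / 2 : ℝ) ^ 12211) ^ ((logStar 2 N - 6) / 2) :=
  oneArm_rate_Z5_three_resplit_of_le_criticalProbI (criticalProbI 5) le_rfl N

/-- **`ℤ⁶`, every `p ≤ p_c(ℤ⁶)`, without Barsky–Grimmett–Newman**: `π_p(N) ≤ (1 − 2⁻²⁹⁶⁴⁷)^⌊(log*₂ N − 6)/2⌋`; at `p = p_c` the type of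
`Resplit.oneArm_rate_Z6_three_resplit`.  An explicit function tending to `0` and nothing more.
builds on p205010 (kernel theorem, internal audit signed; external expert review pending). [cite: KozmaNitzan2024, §4 Theorem 6] -/
theorem oneArm_rate_Z6_three_resplit_of_le_criticalProbI (p : unitInterval) (hpc : p ≤ criticalProbI 6) (N : ℕ) :
    oneArmProb 6 p N ≤ (1 - (1 / 2 : ℝ) ^ 29647) ^ ((logStar 2 N - 6) / 2) :=
  oneArm_le_of_window (d := 6) (by norm_num) (B := fun N => (1 - (1 / 2 : ℝ) ^ 29647) ^ ((logStar 2 N - 6) / 2))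
    (fun q hq hqc N => PkSharp.oneArm_le_base_pow_of_scaleDefect (by norm_num)
      (rsThreeScaleDefect_of_le_criticalProbI_orbit (d := 6) (by norm_num) q hq hqc) (fun m => le_rsLHi _ 6 m)
      (fun m => rsLHi_le_knLHi (d := 6) (by norm_num) knEps_le_half_pow_three_div_two (by positivity) (by norm_num) m) (by positivity)
      rsOrbit_three_six_sharp.1.le (rsTauU_pow_orbit_le_one 6 (by positivity) (by norm_num)) knShiftC_six_eq.le N)
    p hpc N

-- the `p = p_c` instance: the TYPE of `Resplit.oneArm_rate_Z6_three_resplit`, BGN-free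
example (N : ℕ) : oneArmProb 6 (criticalProbI 6) N ≤ (1 - (1 / 2 : ℝ) ^ 29647) ^ ((logStar 2 N - 6) / 2) :=
  oneArm_rate_Z6_three_resplit_of_le_criticalProbI (criticalProbI 6) le_rfl N


/-! ## `d = 7, 8, 9, 10` (sandwiches of `…QuantResplitDisplaysMidD`) -/

/-- **`ℤ⁷`, every `p ≤ p_c(ℤ⁷)`, without Barsky–Grimmett–Newman**: `π_p(N) ≤ (1 − 2^{−69866})^⌊(log*₂ N − 6)/2⌋`; at `p = p_c` the type of
`Resplit.oneArm_rate_Z7_three_resplit`.  An explicit function tending to `0` and nothing more.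
builds on p205010 (kernel theorem, internal audit signed; external expert review pending). [cite: KozmaNitzan2024, §4 Theorem 6] -/
theorem oneArm_rate_Z7_three_resplit_of_le_criticalProbI (p : unitInterval) (hpc : p ≤ criticalProbI 7) (N : ℕ) :
    oneArmProb 7 p N ≤ (1 - (1 / 2 : ℝ) ^ 69866) ^ ((logStar 2 N - 6) / 2) :=
  oneArm_le_of_window (d := 7) (by norm_num) (B := fun N => (1 - (1 / 2 : ℝ) ^ 69866) ^ ((logStar 2 N - 6) / 2))
    (fun q hq hqc N => PkSharp.oneArm_le_base_pow_of_scaleDefect (by norm_num)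
      (rsThreeScaleDefect_of_le_criticalProbI_orbit (d := 7) (by norm_num) q hq hqc) (fun m => le_rsLHi _ 7 m)
      (fun m => rsLHi_le_knLHi (d := 7) (by norm_num) knEps_le_half_pow_three_div_two (by positivity) (by norm_num) m) (by positivity)
      rsOrbit_three_seven_sharp.1.le (rsTauU_pow_orbit_le_one 7 (by positivity) (by norm_num))
      (knShiftC_eq_six_of_le32 (d := 7) (by norm_num) (by norm_num)).le N)
    p hpc N

-- the `p = p_c` instance: the TYPE of `Resplit.oneArm_rate_Z7_three_resplit`, BGN-free
example (N : ℕ) : oneArmProb 7 (criticalProbI 7) N ≤ (1 - (1 / 2 : ℝ) ^ 69866) ^ ((logStar 2 N - 6) / 2) :=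
  oneArm_rate_Z7_three_resplit_of_le_criticalProbI (criticalProbI 7) le_rfl N

/-- **`ℤ⁸`, every `p ≤ p_c(ℤ⁸)`, without Barsky–Grimmett–Newman**: `π_p(N) ≤ (1 − 2^{−161085})^⌊(log*₂ N − 6)/2⌋`; at `p = p_c` the type of
`Resplit.oneArm_rate_Z8_three_resplit`.  An explicit function tending to `0` and nothing more.
builds on p205010 (kernel theorem, internal audit signed; external expert review pending). [cite: KozmaNitzan2024, §4 Theorem 6] -/
theorem oneArm_rate_Z8_three_resplit_of_le_criticalProbI (p : unitInterval) (hpc : p ≤ criticalProbI 8) (N : ℕ) :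
    oneArmProb 8 p N ≤ (1 - (1 / 2 : ℝ) ^ 161085) ^ ((logStar 2 N - 6) / 2) :=
  oneArm_le_of_window (d := 8) (by norm_num) (B := fun N => (1 - (1 / 2 : ℝ) ^ 161085) ^ ((logStar 2 N - 6) / 2))
    (fun q hq hqc N => PkSharp.oneArm_le_base_pow_of_scaleDefect (by norm_num)
      (rsThreeScaleDefect_of_le_criticalProbI_orbit (d := 8) (by norm_num) q hq hqc) (fun m => le_rsLHi _ 8 m)
      (fun m => rsLHi_le_knLHi (d := 8) (by norm_num) knEps_le_half_pow_three_div_two (by positivity) (by norm_num) m) (by positivity)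
      rsOrbit_three_eight_sharp.1.le (rsTauU_pow_orbit_le_one 8 (by positivity) (by norm_num))
      (knShiftC_eq_six_of_le32 (d := 8) (by norm_num) (by norm_num)).le N)
    p hpc N

-- the `p = p_c` instance: the TYPE of `Resplit.oneArm_rate_Z8_three_resplit`, BGN-free
example (N : ℕ) : oneArmProb 8 (criticalProbI 8) N ≤ (1 - (1 / 2 : ℝ) ^ 161085) ^ ((logStar 2 N - 6) / 2) :=
  oneArm_rate_Z8_three_resplit_of_le_criticalProbI (criticalProbI 8) le_rfl N

/-- **`ℤ⁹`, every `p ≤ p_c(ℤ⁹)`, without Barsky–Grimmett–Newman**: `π_p(N) ≤ (1 − 2^{−365242})^⌊(log*₂ N − 6)/2⌋`; at `p = p_c` the type of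
`Resplit.oneArm_rate_Z9_three_resplit`.  An explicit function tending to `0` and nothing more.
builds on p205010 (kernel theorem, internal audit signed; external expert review pending). [cite: KozmaNitzan2024, §4 Theorem 6] -/
theorem oneArm_rate_Z9_three_resplit_of_le_criticalProbI (p : unitInterval) (hpc : p ≤ criticalProbI 9) (N : ℕ) :
    oneArmProb 9 p N ≤ (1 - (1 / 2 : ℝ) ^ 365242) ^ ((logStar 2 N - 6) / 2) :=
  oneArm_le_of_window (d := 9) (by norm_num) (B := fun N => (1 - (1 / 2 : ℝ) ^ 365242) ^ ((logStar 2 N - 6) / 2))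
    (fun q hq hqc N => PkSharp.oneArm_le_base_pow_of_scaleDefect (by norm_num)
      (rsThreeScaleDefect_of_le_criticalProbI_orbit (d := 9) (by norm_num) q hq hqc) (fun m => le_rsLHi _ 9 m)
      (fun m => rsLHi_le_knLHi (d := 9) (by norm_num) knEps_le_half_pow_three_div_two (by positivity) (by norm_num) m) (by positivity)
      rsOrbit_three_nine_sharp.1.le (rsTauU_pow_orbit_le_one 9 (by positivity) (by norm_num))
      (knShiftC_eq_six_of_le32 (d := 9) (by norm_num) (by norm_num)).le N)
    p hpc N

-- the `p = p_c` instance: the TYPE of `Resplit.oneArm_rate_Z9_three_resplit`, BGN-free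
example (N : ℕ) : oneArmProb 9 (criticalProbI 9) N ≤ (1 - (1 / 2 : ℝ) ^ 365242) ^ ((logStar 2 N - 6) / 2) :=
  oneArm_rate_Z9_three_resplit_of_le_criticalProbI (criticalProbI 9) le_rfl N

/-- **`ℤ¹⁰`, every `p ≤ p_c(ℤ¹⁰)`, without Barsky–Grimmett–Newman**: `π_p(N) ≤ (1 − 2^{−817280})^⌊(log*₂ N − 6)/2⌋`; at `p = p_c` the type of
`Resplit.oneArm_rate_Z10_three_resplit`.  An explicit function tending to `0` and nothing more.
builds on p205010 (kernel theorem, internal audit signed; external expert review pending). [cite: KozmaNitzan2024, §4 Theorem 6] -/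
theorem oneArm_rate_Z10_three_resplit_of_le_criticalProbI (p : unitInterval) (hpc : p ≤ criticalProbI 10) (N : ℕ) :
    oneArmProb 10 p N ≤ (1 - (1 / 2 : ℝ) ^ 817280) ^ ((logStar 2 N - 6) / 2) :=
  oneArm_le_of_window (d := 10) (by norm_num) (B := fun N => (1 - (1 / 2 : ℝ) ^ 817280) ^ ((logStar 2 N - 6) / 2))
    (fun q hq hqc N => PkSharp.oneArm_le_base_pow_of_scaleDefect (by norm_num)
      (rsThreeScaleDefect_of_le_criticalProbI_orbit (d := 10) (by norm_num) q hq hqc) (fun m => le_rsLHi _ 10 m)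
      (fun m => rsLHi_le_knLHi (d := 10) (by norm_num) knEps_le_half_pow_three_div_two (by positivity) (by norm_num) m) (by positivity)
      rsOrbit_three_ten_sharp.1.le (rsTauU_pow_orbit_le_one 10 (by positivity) (by norm_num))
      (knShiftC_eq_six_of_le32 (d := 10) (by norm_num) (by norm_num)).le N)
    p hpc N

-- the `p = p_c` instance: the TYPE of `Resplit.oneArm_rate_Z10_three_resplit`, BGN-free
example (N : ℕ) : oneArmProb 10 (criticalProbI 10) N ≤ (1 - (1 / 2 : ℝ) ^ 817280) ^ ((logStar 2 N - 6) / 2) :=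
  oneArm_rate_Z10_three_resplit_of_le_criticalProbI (criticalProbI 10) le_rfl N

/-! ## every `3 ≤ d ≤ 32` -/

/-- **One display for every `3 ≤ d ≤ 32` and every `p ≤ p_c(ℤ^d)`, re-balanced cascade, without Barsky–Grimmett–Newman**:
`π_p(N) ≤ (1 − ((1/2)^66/(d+1)^4)^(d·2^d))^⌊(log*₂ N − 6)/2⌋`; at `p = p_c` the type of `Resplit.oneArm_rate_three_resplit_uniform`.
An explicit function tending to `0` and nothing more; class unchanged.
builds on p205010 (kernel theorem, internal audit signed; external expert review pending). [cite: KozmaNitzan2024, §4 Theorem 6] [cite: DuminilcopinKozmaTassion2020, Proposition 1] -/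
theorem oneArm_rate_three_resplit_uniform_of_le_criticalProbI (hd3 : 3 ≤ d) (hd : d ≤ 32) (p : unitInterval)
    (hpc : p ≤ criticalProbI d) (N : ℕ) :
    oneArmProb d p N ≤ (1 - ((1 / 2 : ℝ) ^ 66 / ((d : ℝ) + 1) ^ 4) ^ (d * 2 ^ d)) ^ ((logStar 2 N - 6) / 2) := by
  haveI : NeZero d := ⟨by omega⟩
  exact oneArm_le_of_window (by omega) (B := fun N => (1 - ((1 / 2 : ℝ) ^ 66 / ((d : ℝ) + 1) ^ 4) ^ (d * 2 ^ d)) ^ ((logStar 2 N - 6) / 2))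
    (fun q hq hqc N => PkSharp.oneArm_le_base_pow_of_scaleDefect (by omega)
      (rsThreeScaleDefect_of_le_criticalProbI_orbit hd3 q hq hqc) (fun m => le_rsLHi _ d m)
      (fun m => rsLHi_le_knLHi (by omega) knEps_le_half_pow_three_div_two (by positivity) (by norm_num) m) (by positivity)
      (rsOrbit_three_ge_closedForm (by omega)) (rsTauU_pow_orbit_le_one d (by positivity) (by norm_num))
      (knShiftC_eq_six_of_le32 hd3 hd).le N)
    p hpc N

-- the `p = p_c` instance: the TYPE of `Resplit.oneArm_rate_three_resplit_uniform`, BGN-free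
example (hd3 : 3 ≤ d) (hd : d ≤ 32) (N : ℕ) :
    oneArmProb d (criticalProbI d) N ≤ (1 - ((1 / 2 : ℝ) ^ 66 / ((d : ℝ) + 1) ^ 4) ^ (d * 2 ^ d)) ^ ((logStar 2 N - 6) / 2) :=
  oneArm_rate_three_resplit_uniform_of_le_criticalProbI hd3 hd (criticalProbI d) le_rfl N

end Resplit

end Summit.CriticalPhenomena.PercolationContinuityZ3.Theorems.Quant

end
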